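import Summits.Ventures.PercRepro2.CaseOneDWorldEdge
import Summits.Ventures.PercRepro2.CaseOneDWorldIEdge
import Summits.Ventures.PercRepro2.OneEdge

/-!
# An `a₂a₃`-edge can be deleted for `(ii)` and for `(i)`: the identities and the sign facts
(blind cell PercRepro2, p1 g30; the theorems are in `CaseOneA2EdgeDelete.lean`)

Let `e₂ = {a₂, a₃}` have weight `r`, `p₀ := p[e₂ ↦ 0]` (the edge deleted) and `p₁ := p[e₂ ↦ 1]`
(the edge forced open). When `e₂` is open and `a₁ ↮ a₂`, the statement vertex is in `C₂`, so
`Q ∩ {a₃ ∈ C₁} = ∅` and `PD = ∅`: every `a₃`-mass and the PD pair pick up the factor `1 − r`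
(`prob_a2_edge_of_subset_Dw`, `Dpd_a2_edge`, `Dpdo_a2_edge`), while `P(Q)` and `P(Q, b ∈ C₂)`
are the `r`-mixtures `(1 − r) P₀ + r P₁` (`prob_eq_pin`). Hence (**`iiExpr_a2_edge`**)

  `iiExpr p = (1 − r)² · [ (1 − r) · iiExpr p₀ + r · M ]`,

`the mixed term `M = D₀ (X₁ P₄ − Y₁ P₃) − D₀ₒ (X₁ P₂ − Y₁ P₁)`` being the `(ii)` form of `G − e₂` at its own PD
pair but with the `b`-pair `(Y₁, X₁) = (P₁(Q, b ∈ C₂), P₁(Q))` of the graph with `e₂` forced open.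
With `e₂` forced open, `Q = Q₀ ∩ {a₃ ∉ C₁}` (`not_conn_a1_a2_update_true_iff`), so
`X₁ = X₀ − P₀(Q, a₃ ∈ C₁)` and `Y₁ ≥ Y₀ − P₀(Q, b ∈ C₂, a₃ ∈ C₁)`; BHK 1.4 then gives
`X₀ Y₁ − X₁ Y₀ ≥ 0` (the forced-open `b`-threshold is at least the `b`-threshold of `G − e₂`,
**`a2_bThreshold_nonneg`**), and the odds lemma gives `D₀ₒ P₁ − D₀ P₃ ≥ 0`; the identity
`X₀ · M = X₁ · iiExpr p₀ + (X₀ Y₁ − X₁ Y₀)(D₀ₒ P₁ − D₀ P₃)` closes the case: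
**`zSplitII_of_a2_edge`**: `ZSplitII p₀ ⟹ ZSplitII p`. The mirror for `(i)` uses BHK 1.3
(`X₀ R₁ − X₁ R₀ ≤ 0` for the `b ∈ C₁`-masses) and the odds lemma with the opposite sign:
**`zSplitI_of_a2_edge`**: `ZSplitI p₀ ⟹ ZSplitI p`. Any multiplicity by iteration. So for `(i)` and
`(ii)` at the PD pair the statement vertex may be assumed to have no `a₂`-edges. (The Q-threshold
forms are NOT covered: their `o`-pair mixes too; see the record.) Own code; standard axioms.
-/

namespace Summit.Ventures.PercRepro2

namespace CaseOne

/-! ## Pointwise: forcing an `a₂a₃`-edge open -/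

section Pointwise
variable {V : Type*} {E : Type*} [DecidableEq E] {ends : E → Sym2 V} {a₁ a₂ a₃ : V} {e₂ : E}

/-- With `e₂ = {a₂, a₃}` forced open, `a₁ ↮ a₂` iff with `e₂` forced closed `a₁ ↮ a₂` and `a₁ ↮ a₃`. -/
lemma not_conn_a1_a2_update_true_iff (he : ends e₂ = s(a₂, a₃)) (ω : Config E) :
    ¬ Conn ends (Function.update ω e₂ true) a₁ a₂ ↔
      ¬ Conn ends (Function.update ω e₂ false) a₁ a₂ ∧
        ¬ Conn ends (Function.update ω e₂ false) a₁ a₃ := by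
  set ω₀ := Function.update ω e₂ false with hω₀
  have hω₁ : Function.update ω e₂ true = Function.update ω₀ e₂ true := by
    rw [hω₀, Function.update_idem]
  rw [hω₁, OneEdge.conn_update_true_iff he ω₀ a₁ a₂]
  constructor
  · intro h
    exact ⟨fun h1 => h (Or.inl h1), fun h3 => h (Or.inr (Or.inr ⟨h3, conn_refl _ _ _⟩))⟩
  · rintro ⟨h1, h3⟩ (h | ⟨h, _⟩ | ⟨h, _⟩)
    · exact h1 h
    · exact h1 h
    · exact h3 h

/-- With `e₂ = {a₂, a₃}` forced open and `a₁ ↮ a₂`, an `a₁`-connection is one with `e₂` closed. -/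
lemma conn_a1_update_true_iff (he : ends e₂ = s(a₂, a₃)) (ω : Config E)
    (hQ : ¬ Conn ends (Function.update ω e₂ true) a₁ a₂) (y : V) :
    Conn ends (Function.update ω e₂ true) a₁ y ↔ Conn ends (Function.update ω e₂ false) a₁ y := by
  obtain ⟨h1, h3⟩ := (not_conn_a1_a2_update_true_iff he ω).1 hQ
  set ω₀ := Function.update ω e₂ false with hω₀
  have hω₁ : Function.update ω e₂ true = Function.update ω₀ e₂ true := by
    rw [hω₀, Function.update_idem]
  rw [hω₁, OneEdge.conn_update_true_iff he ω₀ a₁ y]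
  constructor
  · rintro (h | ⟨h, _⟩ | ⟨h, _⟩)
    · exact h
    · exact absurd h h1
    · exact absurd h h3
  · exact fun h => Or.inl h

/-- Forcing an edge open preserves every connection. -/
lemma conn_update_true_of_update_false {e : E} (ω : Config E) {u v : V}
    (h : Conn ends (Function.update ω e false) u v) : Conn ends (Function.update ω e true) u v := by
  refine conn_mono ?_ h
  intro e'
  by_cases hee : e' = e
  · subst hee; simp
  · rw [Function.update_of_ne hee, Function.update_of_ne hee]

/-- **`Q` with `e₂` forced open = `Q ∩ {a₃ ∉ C₁}` with `e₂` forced closed** (as preimages). -/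
lemma preimage_Q_update_true (he : ends e₂ = s(a₂, a₃)) :
    (fun ω : Config E => Function.update ω e₂ true) ⁻¹' (connEvent ends a₁ a₂)ᶜ =
      (fun ω : Config E => Function.update ω e₂ false) ⁻¹'
        ((connEvent ends a₁ a₂)ᶜ ∩ (connEvent ends a₁ a₃)ᶜ) := by
  ext ω
  simp only [Set.mem_preimage, Set.mem_inter_iff, Set.mem_compl_iff, mem_connEvent]
  exact not_conn_a1_a2_update_true_iff he ω

/-- **`Q ∩ {b ∈ C₂}` with `e₂` forced open contains `Q ∩ {a₃ ∉ C₁} ∩ {b ∈ C₂}` with `e₂` forced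
closed** (as preimages). -/
lemma preimage_QB_update_true (he : ends e₂ = s(a₂, a₃)) (b : V) :
    (fun ω : Config E => Function.update ω e₂ false) ⁻¹'
        (connEvent ends a₂ b ∩ (connEvent ends a₁ a₂)ᶜ ∩ (connEvent ends a₁ a₃)ᶜ) ⊆
      (fun ω : Config E => Function.update ω e₂ true) ⁻¹'
        (connEvent ends a₂ b ∩ (connEvent ends a₁ a₂)ᶜ) := by
  intro ω hω
  simp only [Set.mem_preimage, Set.mem_inter_iff, Set.mem_compl_iff, mem_connEvent] at hω ⊢
  obtain ⟨⟨hb, h1⟩, h3⟩ := hω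
  exact ⟨conn_update_true_of_update_false ω hb, (not_conn_a1_a2_update_true_iff he ω).2 ⟨h1, h3⟩⟩

/-- **`Q ∩ {b ∈ C₁}` with `e₂` forced open = `Q ∩ {a₃ ∉ C₁} ∩ {b ∈ C₁}` with `e₂` forced closed**
(as preimages). -/
lemma preimage_QB1_update_true (he : ends e₂ = s(a₂, a₃)) (b : V) :
    (fun ω : Config E => Function.update ω e₂ true) ⁻¹'
        (connEvent ends a₁ b ∩ (connEvent ends a₁ a₂)ᶜ) =
      (fun ω : Config E => Function.update ω e₂ false) ⁻¹'
        (connEvent ends a₁ b ∩ (connEvent ends a₁ a₂)ᶜ ∩ (connEvent ends a₁ a₃)ᶜ) := by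
  ext ω
  simp only [Set.mem_preimage, Set.mem_inter_iff, Set.mem_compl_iff, mem_connEvent]
  constructor
  · rintro ⟨hb, hQ⟩
    obtain ⟨h1, h3⟩ := (not_conn_a1_a2_update_true_iff he ω).1 hQ
    exact ⟨⟨(conn_a1_update_true_iff he ω hQ b).1 hb, h1⟩, h3⟩
  · rintro ⟨⟨hb, h1⟩, h3⟩
    have hQ : ¬ Conn ends (Function.update ω e₂ true) a₁ a₂ :=
      (not_conn_a1_a2_update_true_iff he ω).2 ⟨h1, h3⟩
    exact ⟨(conn_a1_update_true_iff he ω hQ b).2 hb, hQ⟩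

omit [DecidableEq E] in
/-- `Q ∩ {a₃ ∈ C₁}` lies in the D-world. -/
lemma A_inter_Q_subset_Dw :
    connEvent ends a₁ a₃ ∩ (connEvent ends a₁ a₂)ᶜ ⊆ Dw ends a₁ a₂ a₃ := by
  intro ω hω
  simp only [Set.mem_inter_iff, Set.mem_compl_iff, mem_connEvent] at hω
  exact ⟨hω.2, not_conn_a2_a3_of_A hω.1 hω.2⟩

end Pointwise

/-! ## The masses of `G` in terms of `G − e₂` and `G` with `e₂` forced open -/

section Masses
variable {V : Type*} {E : Type*} [Fintype E] [DecidableEq E] {R : Type*} [CommRing R]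
variable {ends : E → Sym2 V} {a₁ a₂ a₃ : V} {e₂ : E}

/-- Pinning `e` open is the probability of the preimage under forcing `e` open (as in
`GcTransport.lean`, restated here to keep the import closure small). -/
lemma prob_update_one_eq_preimage' (p : E → R) (e : E) (A : Set (Config E)) :
    prob (Function.update p e 1) A = prob p ((fun ω => Function.update ω e true) ⁻¹' A) := by
  rw [prob_eq_expect_indicator, prob_eq_expect_indicator, expect_update_one]
  unfold expect
  refine Finset.sum_congr rfl fun ω _ => ?_
  by_cases h : Function.update ω e true ∈ A
  · have h' : ω ∈ (fun ω => Function.update ω e true) ⁻¹' A := h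
    simp only [Set.indicator_of_mem h, Set.indicator_of_mem h', Pi.one_apply]
  · have h' : ω ∉ (fun ω => Function.update ω e true) ⁻¹' A := h
    simp only [Set.indicator_of_notMem h, Set.indicator_of_notMem h']

/-- Pinning `e` closed is the probability of the preimage under forcing `e` closed. -/
lemma prob_update_zero_eq_preimage' (p : E → R) (e : E) (A : Set (Config E)) :
    prob (Function.update p e 0) A = prob p ((fun ω => Function.update ω e false) ⁻¹' A) := by
  rw [prob_eq_expect_indicator, prob_eq_expect_indicator, expect_update_zero]
  unfold expect
  refine Finset.sum_congr rfl fun ω _ => ?_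
  by_cases h : Function.update ω e false ∈ A
  · have h' : ω ∈ (fun ω => Function.update ω e false) ⁻¹' A := h
    simp only [Set.indicator_of_mem h, Set.indicator_of_mem h', Pi.one_apply]
  · have h' : ω ∉ (fun ω => Function.update ω e false) ⁻¹' A := h
    simp only [Set.indicator_of_notMem h, Set.indicator_of_notMem h']

/-- Every `a₃`-mass picks up the factor `1 − r` along an `a₂a₃`-edge. -/
lemma prob_a2_edge_of_subset_AQ (p : E → R) (he : ends e₂ = s(a₂, a₃)) {Y : Set (Config E)}
    (hY : Y ⊆ connEvent ends a₁ a₃ ∩ (connEvent ends a₁ a₂)ᶜ) :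
    prob p Y = (1 - p e₂) * prob (Function.update p e₂ 0) Y :=
  prob_a2_edge_of_subset_Dw p he (hY.trans A_inter_Q_subset_Dw)

/-- **Identity: `(ii)` along an `a₂a₃`-edge.** -/
theorem iiExpr_a2_edge (p : E → R) (he : ends e₂ = s(a₂, a₃)) (o b : V) :
    iiExpr p ends o a₁ a₂ a₃ b =
      (1 - p e₂) ^ 2 * ((1 - p e₂) * iiExpr (Function.update p e₂ 0) ends o a₁ a₂ a₃ b +
        p e₂ * (Dpd (Function.update p e₂ 0) ends a₁ a₂ a₃ *
          (prob (Function.update p e₂ 1) (connEvent ends a₁ a₂)ᶜ *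
          prob (Function.update p e₂ 0) (connEvent ends a₂ b ∩ connEvent ends a₁ a₃ ∩
          connEvent ends a₂ o ∩ (connEvent ends a₁ a₂)ᶜ) -
          prob (Function.update p e₂ 1) (connEvent ends a₂ b ∩ (connEvent ends a₁ a₂)ᶜ) *
          prob (Function.update p e₂ 0) (connEvent ends a₁ a₃ ∩ connEvent ends a₂ o ∩
          (connEvent ends a₁ a₂)ᶜ)) -
          Dpdo (Function.update p e₂ 0) ends o a₁ a₂ a₃ *
          (prob (Function.update p e₂ 1) (connEvent ends a₁ a₂)ᶜ *
          prob (Function.update p e₂ 0) (connEvent ends a₂ b ∩ connEvent ends a₁ a₃ ∩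
          (connEvent ends a₁ a₂)ᶜ) -
          prob (Function.update p e₂ 1) (connEvent ends a₂ b ∩ (connEvent ends a₁ a₂)ᶜ) *
          prob (Function.update p e₂ 0) (connEvent ends a₁ a₃ ∩ (connEvent ends a₁ a₂)ᶜ)))) := by
  rw [iiExpr_eq_iiExprT, iiExpr_eq_iiExprT, iiExprT_eq, iiExprT_eq,
    Dpd_a2_edge p he, Dpdo_a2_edge p he o,
    prob_a2_edge_of_subset_AQ p he (Y := connEvent ends a₂ b ∩ connEvent ends a₁ a₃ ∩
      connEvent ends a₂ o ∩ (connEvent ends a₁ a₂)ᶜ) (fun _ h => ⟨h.1.1.2, h.2⟩),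
    prob_a2_edge_of_subset_AQ p he (Y := connEvent ends a₁ a₃ ∩ connEvent ends a₂ o ∩
      (connEvent ends a₁ a₂)ᶜ) (fun _ h => ⟨h.1.1, h.2⟩),
    prob_a2_edge_of_subset_AQ p he (Y := connEvent ends a₂ b ∩ connEvent ends a₁ a₃ ∩
      (connEvent ends a₁ a₂)ᶜ) (fun _ h => ⟨h.1.2, h.2⟩),
    prob_a2_edge_of_subset_AQ p he (Y := connEvent ends a₁ a₃ ∩ (connEvent ends a₁ a₂)ᶜ)
      (fun _ h => h),
    prob_eq_pin p (connEvent ends a₁ a₂)ᶜ e₂,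
    prob_eq_pin p (connEvent ends a₂ b ∩ (connEvent ends a₁ a₂)ᶜ) e₂]
  ring

/-- **Identity: `(i)` along an `a₂a₃`-edge.** -/
theorem iExpr_a2_edge (p : E → R) (he : ends e₂ = s(a₂, a₃)) (o b : V) :
    iExpr p ends o a₁ a₂ a₃ b =
      (1 - p e₂) ^ 2 * ((1 - p e₂) * iExpr (Function.update p e₂ 0) ends o a₁ a₂ a₃ b +
        p e₂ * (-(Dpd (Function.update p e₂ 0) ends a₁ a₂ a₃ *
          (prob (Function.update p e₂ 1) (connEvent ends a₁ a₂)ᶜ *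
          prob (Function.update p e₂ 0) (connEvent ends a₁ b ∩ connEvent ends a₁ a₃ ∩
          connEvent ends a₂ o ∩ (connEvent ends a₁ a₂)ᶜ) -
          prob (Function.update p e₂ 1) (connEvent ends a₁ b ∩ (connEvent ends a₁ a₂)ᶜ) *
          prob (Function.update p e₂ 0) (connEvent ends a₁ a₃ ∩ connEvent ends a₂ o ∩
          (connEvent ends a₁ a₂)ᶜ))) +
          Dpdo (Function.update p e₂ 0) ends o a₁ a₂ a₃ *
          (prob (Function.update p e₂ 1) (connEvent ends a₁ a₂)ᶜ *
          prob (Function.update p e₂ 0) (connEvent ends a₁ b ∩ connEvent ends a₁ a₃ ∩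
          (connEvent ends a₁ a₂)ᶜ) -
          prob (Function.update p e₂ 1) (connEvent ends a₁ b ∩ (connEvent ends a₁ a₂)ᶜ) *
          prob (Function.update p e₂ 0) (connEvent ends a₁ a₃ ∩ (connEvent ends a₁ a₂)ᶜ)))) := by
  rw [iExpr_eq_iExprT, iExpr_eq_iExprT, iExprT_eq, iExprT_eq,
    Dpd_a2_edge p he, Dpdo_a2_edge p he o,
    prob_a2_edge_of_subset_AQ p he (Y := connEvent ends a₁ b ∩ connEvent ends a₁ a₃ ∩
      connEvent ends a₂ o ∩ (connEvent ends a₁ a₂)ᶜ) (fun _ h => ⟨h.1.1.2, h.2⟩),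
    prob_a2_edge_of_subset_AQ p he (Y := connEvent ends a₁ a₃ ∩ connEvent ends a₂ o ∩
      (connEvent ends a₁ a₂)ᶜ) (fun _ h => ⟨h.1.1, h.2⟩),
    prob_a2_edge_of_subset_AQ p he (Y := connEvent ends a₁ b ∩ connEvent ends a₁ a₃ ∩
      (connEvent ends a₁ a₂)ᶜ) (fun _ h => ⟨h.1.2, h.2⟩),
    prob_a2_edge_of_subset_AQ p he (Y := connEvent ends a₁ a₃ ∩ (connEvent ends a₁ a₂)ᶜ)
      (fun _ h => h),
    prob_eq_pin p (connEvent ends a₁ a₂)ᶜ e₂,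
    prob_eq_pin p (connEvent ends a₁ b ∩ (connEvent ends a₁ a₂)ᶜ) e₂]
  ring

/-- `P₁(Q) = P₀(Q) − P₀(Q, a₃ ∈ C₁)`: forcing `e₂` open removes exactly the `a₃ ∈ C₁` part of `Q`. -/
theorem prob_Q_update_one (p : E → R) (he : ends e₂ = s(a₂, a₃)) :
    prob (Function.update p e₂ 1) (connEvent ends a₁ a₂)ᶜ =
      prob (Function.update p e₂ 0) (connEvent ends a₁ a₂)ᶜ -
        prob (Function.update p e₂ 0) (connEvent ends a₁ a₃ ∩ (connEvent ends a₁ a₂)ᶜ) := by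
  rw [prob_update_one_eq_preimage', preimage_Q_update_true he, ← prob_update_zero_eq_preimage']
  have e1 := prob_inter_add_prob_inter_compl (Function.update p e₂ 0) (connEvent ends a₁ a₂)ᶜ
    (connEvent ends a₁ a₃)
  rw [Set.inter_comm (connEvent ends a₁ a₂)ᶜ (connEvent ends a₁ a₃)] at e1
  linear_combination e1

/-- `P₁(Q, b ∈ C₁) = P₀(Q, b ∈ C₁) − P₀(Q, b ∈ C₁, a₃ ∈ C₁)`. -/
theorem prob_QB1_update_one (p : E → R) (he : ends e₂ = s(a₂, a₃)) (b : V) :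
    prob (Function.update p e₂ 1) (connEvent ends a₁ b ∩ (connEvent ends a₁ a₂)ᶜ) =
      prob (Function.update p e₂ 0) (connEvent ends a₁ b ∩ (connEvent ends a₁ a₂)ᶜ) -
        prob (Function.update p e₂ 0) (connEvent ends a₁ b ∩ connEvent ends a₁ a₃ ∩
          (connEvent ends a₁ a₂)ᶜ) := by
  rw [prob_update_one_eq_preimage', preimage_QB1_update_true he b, ← prob_update_zero_eq_preimage']
  have e1 := prob_inter_add_prob_inter_compl (Function.update p e₂ 0)
    (connEvent ends a₁ b ∩ (connEvent ends a₁ a₂)ᶜ) (connEvent ends a₁ a₃)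
  have e2 : connEvent ends a₁ b ∩ (connEvent ends a₁ a₂)ᶜ ∩ connEvent ends a₁ a₃ =
      connEvent ends a₁ b ∩ connEvent ends a₁ a₃ ∩ (connEvent ends a₁ a₂)ᶜ := by
    ext ω; simp only [Set.mem_inter_iff]; tauto
  rw [e2] at e1
  linear_combination e1

end Masses

/-! ## The two sign facts and the theorems -/

section Signs
variable {V : Type*} {E : Type*} [Fintype E] [DecidableEq E] [Fintype V] [DecidableEq V]
  {R : Type*} [Field R] [LinearOrder R] [IsStrictOrderedRing R]
variable {ends : E → Sym2 V} {a₁ a₂ a₃ : V} {e₂ : E}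

omit [Fintype V] [DecidableEq V] in
/-- `P₁(Q, b ∈ C₂) ≥ P₀(Q, b ∈ C₂) − P₀(Q, b ∈ C₂, a₃ ∈ C₁)`. -/
theorem prob_QB_update_one_ge (p : E → R) (hp : IsProbVec p) (he : ends e₂ = s(a₂, a₃)) (b : V) :
    prob (Function.update p e₂ 0) (connEvent ends a₂ b ∩ (connEvent ends a₁ a₂)ᶜ) -
        prob (Function.update p e₂ 0) (connEvent ends a₂ b ∩ connEvent ends a₁ a₃ ∩
          (connEvent ends a₁ a₂)ᶜ) ≤
      prob (Function.update p e₂ 1) (connEvent ends a₂ b ∩ (connEvent ends a₁ a₂)ᶜ) := by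
  have hsub := prob_mono hp (preimage_QB_update_true (a₁ := a₁) he b)
  rw [← prob_update_one_eq_preimage', ← prob_update_zero_eq_preimage'] at hsub
  have e1 := prob_inter_add_prob_inter_compl (Function.update p e₂ 0)
    (connEvent ends a₂ b ∩ (connEvent ends a₁ a₂)ᶜ) (connEvent ends a₁ a₃)
  have e2 : connEvent ends a₂ b ∩ (connEvent ends a₁ a₂)ᶜ ∩ connEvent ends a₁ a₃ =
      connEvent ends a₂ b ∩ connEvent ends a₁ a₃ ∩ (connEvent ends a₁ a₂)ᶜ := by
    ext ω; simp only [Set.mem_inter_iff]; tauto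
  rw [e2] at e1
  linarith

/-- **The forced-open `b`-threshold dominates**: `X₀ Y₁ − X₁ Y₀ ≥ 0` with `X₁ = P₁(Q)`,
`Y₁ = P₁(Q, b ∈ C₂)` (BHK 1.4 in `G − e₂`). -/
theorem a2_bThreshold_nonneg (p : E → R) (hp : IsProbVec p) (he : ends e₂ = s(a₂, a₃)) (b : V) :
    0 ≤ prob (Function.update p e₂ 0) (connEvent ends a₁ a₂)ᶜ *
          prob (Function.update p e₂ 1) (connEvent ends a₂ b ∩ (connEvent ends a₁ a₂)ᶜ) -
        prob (Function.update p e₂ 1) (connEvent ends a₁ a₂)ᶜ *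
          prob (Function.update p e₂ 0) (connEvent ends a₂ b ∩ (connEvent ends a₁ a₂)ᶜ) := by
  set p₀ := Function.update p e₂ 0 with hp₀
  have hp0 : IsProbVec p₀ := hp.update e₂ le_rfl zero_le_one
  have hbhk := bhk_cross_cluster p₀ hp0 ends a₂ a₁ (isUpperSet_mem_setOf b) (isUpperSet_mem_setOf a₃)
  rw [← connEvent_eq_clusterInEvent ends a₂ b, ← connEvent_eq_clusterInEvent ends a₁ a₃,
    connEvent_comm ends a₂ a₁] at hbhk
  have hX := prob_Q_update_one (a₁ := a₁) p he
  have hY := prob_QB_update_one_ge (a₁ := a₁) p hp he b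
  have hX0 : 0 ≤ prob p₀ (connEvent ends a₁ a₂)ᶜ := prob_nonneg hp0 _
  have hY0 : 0 ≤ prob p₀ (connEvent ends a₂ b ∩ (connEvent ends a₁ a₂)ᶜ) := prob_nonneg hp0 _
  rw [hX]
  nlinarith [mul_le_mul_of_nonneg_left hY hX0, hbhk, hX0, hY0]

/-- **The forced-open `b ∈ C₁`-threshold is dominated**: `X₀ R₁ − X₁ R₀ ≤ 0` with `R₁ = P₁(Q, b ∈ C₁)`
(BHK 1.3 in `G − e₂`). -/
theorem a2_b1Threshold_nonpos (p : E → R) (hp : IsProbVec p) (he : ends e₂ = s(a₂, a₃)) (b : V) :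
    prob (Function.update p e₂ 0) (connEvent ends a₁ a₂)ᶜ *
          prob (Function.update p e₂ 1) (connEvent ends a₁ b ∩ (connEvent ends a₁ a₂)ᶜ) -
        prob (Function.update p e₂ 1) (connEvent ends a₁ a₂)ᶜ *
          prob (Function.update p e₂ 0) (connEvent ends a₁ b ∩ (connEvent ends a₁ a₂)ᶜ) ≤ 0 := by
  set p₀ := Function.update p e₂ 0 with hp₀
  have hp0 : IsProbVec p₀ := hp.update e₂ le_rfl zero_le_one
  have hbhk := bhk_same_cluster_events p₀ hp0 ends a₁ a₂ (isUpperSet_mem_setOf b)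
    (isUpperSet_mem_setOf a₃)
  rw [← connEvent_eq_clusterInEvent ends a₁ b, ← connEvent_eq_clusterInEvent ends a₁ a₃] at hbhk
  have hX := prob_Q_update_one (a₁ := a₁) p he
  have hR := prob_QB1_update_one (a₁ := a₁) p he b
  rw [hX, hR]
  linarith

end Signs

end CaseOne

end Summit.Ventures.PercRepro2
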